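import Mathlib
import Summits.AtomisticToContinuum.HydrodynamicLimit.Theorems.ImplosionDichotomyDenseExcursionCavityNegExpBranch
import Summits.AtomisticToContinuum.HydrodynamicLimit.Theorems.ImplosionDichotomyDenseExcursionCavityResDescent

/-!
# The cavity resolvent at the four genuine jet resonances `ν(Λ) ∈ {0, 1, 2, 3}` of the sonic point, and pointwise
# existence of the smooth centre-regular resolvent solution on the whole region (theorem T6)
# (crux `DenseExcursion`, line `sonic-cavity-renewal`, bricks for stub `stub_cavityResolventCk`)

Helper file (`--supports stmt-AtomisticToContinuum-12586`, line lead a2, stub-worker E2 for `stub_cavityResolventCk`,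
theorem T6 of its decomposition, RESONANT CASE). Registered helpers:

* `sonic_branch_resonant` — THE LOCAL THEORY AT A JET RESONANCE: for a monatomic tube profile and `Λ` whose Frobenius
  exponent `ν(Λ) = (b₊₊(0) − Λ)/κ` at the repulsive sonic point is a natural number `m`, there is `0 < δ ≤ 1` such that on
  `(−δ, δ)` (i) the HOMOGENEOUS resolvent equations have a non-trivial `C^∞` solution (the exponent-`m` branch), and
  (ii) EITHER for every pair of `C^∞` sources the sourced equations `Λŵ − linW = f`, `Λŝ − linS = g` have a `C^∞` solution
  (compatibility coefficient `ℓ ≠ 0`), OR the homogeneous equations have TWO `C^∞` solutions of which no non-trivial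
  combination vanishes identically on `(−δ, 0)` (`ℓ = 0`). Mechanism: the characteristic system divided by `η`, `c₋` is
  the scalar first-kind singular system of `fuchs_branch_resonant` (`…CavityResDescent`: reduction of the resonance by
  `m + 1` differentiations to the Volterra construction at exponent `−1`; no gap, no power series), coefficients cut off
  to global smooth functions as in `sonic_smooth_branch_negexp`; the two homogeneous solutions are normalised by
  `(q(0), p⁽ᵐ⁾(0)) = (1, 0)`, `(0, 1)` (one-sided continuity of `q` and `p⁽ᵐ⁾` at `0` gives the non-degeneracy).
* `mode_of_two_local_branches` — THE MATCHING COUNT AT A DEGENERATE RESONANCE: two such local homogeneous solutions force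
  a smooth radial mode at `Λ`. Matching the centre-regular homogeneous branch (continued to `x ≤ −δ/4`) against the
  two-dimensional local family at `x* = −δ/2` has THREE unknowns and TWO equations: if
  `T(a, t) = a·(centre)(x*) − t·(first local)(x*)` is not injective, a kernel vector glues (`glue_centre_sonic`) to a
  global homogeneous regular solution, non-trivial at a point `x < −1` (`a ≠ 0`) or on `(−δ, 0)` (`a = 0`); if `T` is
  bijective, `T(a, t) = (second local)(x*)` glues `a`·(centre) to (second) + `t`·(first), non-trivial on `(−δ, 0)`.
* `cavity_resolvent_pointwise_res` — EXISTENCE AT THE JET RESONANCES: alternative (ii), first case: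
  `cavity_resolvent_of_local`; second case: a mode at `Λ`, excluded by `rate_eq_of_window` and the discs.
* `cavity_resolvent_pointwise` (T6, THE SINGLE ENTRY POINT) — for EVERY `Λ` of the region `Re Λ ≥ −1/5` outside the
  `1/20`-discs around `0`, `Λ₁`, `r` and every regular source, the resolvent equation has a smooth centre-regular solution
  on `ℝ` (`cavity_resolvent_pointwise_offres` off the four jet resonances, `cavity_resolvent_pointwise_res` at them).
  Uniqueness on `x ≤ 1` is the landed `cavityResolvent_unique`.

Sources: folklore (Coddington–Levinson 1955 Ch. 4 §8; Evans-function matching). Everything proved; no new definitions.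
-/

noncomputable section

open Set Filter
open scoped Topology ContDiff

namespace Summit.AtomisticToContinuum.HydrodynamicLimit.Theorems.SonicCavityRenewal

open Summit.AtomisticToContinuum.HydrodynamicLimit.Theorems.R2OneModeTwoConditions

/-- ONE-SIDED CONTINUITY ARGUMENT: a function continuous at `0` which vanishes on `(−ρ, 0)` vanishes at `0`. [folklore] -/
theorem eq_zero_of_eq_zero_on_left {Φ : ℝ → ℂ} {ρ : ℝ} (hρ : 0 < ρ) (hc : ContinuousAt Φ 0)
    (h : ∀ y ∈ Ioo (-ρ) 0, Φ y = 0) : Φ 0 = 0 := by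
  have h1 : Tendsto Φ (𝓝[<] (0 : ℝ)) (𝓝 (Φ 0)) := hc.tendsto.mono_left nhdsWithin_le_nhds
  have h2 : Tendsto Φ (𝓝[<] (0 : ℝ)) (𝓝 0) := by
    refine (tendsto_const_nhds (x := (0 : ℂ))).congr' ?_
    filter_upwards [Ioo_mem_nhdsLT (show -ρ < (0 : ℝ) by linarith)] with y hy
    exact (h y hy).symm
  exact tendsto_nhds_unique h1 h2

/-- **Registered helper `sonic_branch_resonant`: THE LOCAL THEORY OF THE CAVITY RESOLVENT AT A JET RESONANCE
`ν(Λ) = m ∈ ℕ` OF THE REPULSIVE SONIC POINT.** See the module docstring. [folklore] -/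
theorem sonic_branch_resonant : ∀ (r : ℝ) (W S : ℝ → ℝ), IsMonatomicProfile r W S → CavityTube r W S → ∀ (Λ : ℂ) (m : ℕ), ((((2 / 3 * deriv W 0 + 2 * deriv S 0 + 2 * W 0 + 4 * S 0 - r : ℝ) : ℂ) - Λ) / ((-(deriv W 0 + deriv S 0) : ℝ) : ℂ)) = (m : ℂ) → ∃ δ : ℝ, 0 < δ ∧ δ ≤ 1 ∧ (∃ ph qh : ℝ → ℂ, ContDiffOn ℝ ∞ ph (Set.Ioo (-δ) δ) ∧ ContDiffOn ℝ ∞ qh (Set.Ioo (-δ) δ) ∧ (∀ x ∈ Set.Ioo (-δ) δ, Λ * ph x - linW r W S ph qh x = 0 ∧ Λ * qh x - linS r W S ph qh x = 0) ∧ ∃ x ∈ Set.Ioo (-δ) δ, ph x ≠ 0 ∨ qh x ≠ 0) ∧ ((∀ (f g : ℝ → ℂ), ContDiff ℝ ∞ f → ContDiff ℝ ∞ g → ∃ pp qp : ℝ → ℂ, ContDiffOn ℝ ∞ pp (Set.Ioo (-δ) δ) ∧ ContDiffOn ℝ ∞ qp (Set.Ioo (-δ) δ) ∧ ∀ x ∈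 Set.Ioo (-δ) δ, Λ * pp x - linW r W S pp qp x = f x ∧ Λ * qp x - linS r W S pp qp x = g x) ∨ (∃ w₁ s₁ w₂ s₂ : ℝ → ℂ, ContDiffOn ℝ ∞ w₁ (Set.Ioo (-δ) δ) ∧ ContDiffOn ℝ ∞ s₁ (Set.Ioo (-δ) δ) ∧ ContDiffOn ℝ ∞ w₂ (Set.Ioo (-δ) δ) ∧ ContDiffOn ℝ ∞ s₂ (Set.Ioo (-δ) δ) ∧ (∀ x ∈ Set.Ioo (-δ) δ, Λ * w₁ x - linW r W S w₁ s₁ x = 0 ∧ Λ * s₁ x - linS r W S w₁ s₁ x = 0) ∧ (∀ x ∈ Set.Ioo (-δ) δ, Λ * w₂ x - linW r W S w₂ s₂ x = 0 ∧ Λ * s₂ x - linS r W S w₂ s₂ x = 0) ∧ ∀ t₁ t₂ : ℂ, (∀ x ∈ Set.Ioo (-δ) 0, t₁ * w₁ x + t₂ * w₂ x = 0 ∧ t₁ * s₁ x + t₂ * s₂ x = 0) → t₁ = 0 ∧ t₂ = 0)) := by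
  intro r W S hP hT Λ m hνm
  obtain ⟨ρ, hρ, hρ1, hxη, hη0, hκ, -, hne, -, -, ⟨ι₁, ι₂, hι₁, hι₂, hιeq, -⟩, -⟩ := sonic_frobenius_pair r W S hP hT 0 0
  obtain ⟨-, -, hW, hS, -, -⟩ := hP
  have hW' : ContDiff ℝ ∞ (deriv W) := (contDiff_infty_iff_deriv.1 hW).2
  have hS' : ContDiff ℝ ∞ (deriv S) := (contDiff_infty_iff_deriv.1 hS).2
  set ν : ℂ := ((((2 / 3 * deriv W 0 + 2 * deriv S 0 + 2 * W 0 + 4 * S 0 - r : ℝ) : ℂ) - Λ) /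
    ((-(deriv W 0 + deriv S 0) : ℝ) : ℂ)) with hνdef
  have hU : IsOpen (Ioo (-ρ) ρ) := isOpen_Ioo
  have h0U : (0 : ℝ) ∈ Ioo (-ρ) ρ := ⟨by linarith, hρ⟩
  set Bpp : ℝ → ℂ := fun x => ((2 / 3 * deriv W x + 2 * W x - r + 2 * deriv S x + 4 * S x : ℝ) : ℂ) with hBpp
  set Bpm : ℝ → ℂ := fun x => ((deriv W x / 3 + deriv S x + 2 * S x : ℝ) : ℂ) with hBpm
  set Bmp : ℝ → ℂ := fun x => ((deriv W x / 3 - deriv S x - 2 * S x : ℝ) : ℂ) with hBmp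
  set Bmm : ℝ → ℂ := fun x => ((2 / 3 * deriv W x + 2 * W x - r - 2 * deriv S x - 4 * S x : ℝ) : ℂ) with hBmm
  have sBpp : ContDiff ℝ ∞ Bpp := Complex.ofRealCLM.contDiff.comp (((((contDiff_const.mul hW').add
    (contDiff_const.mul hW)).sub contDiff_const).add (contDiff_const.mul hS')).add (contDiff_const.mul hS))
  have sBpm : ContDiff ℝ ∞ Bpm := Complex.ofRealCLM.contDiff.comp (((hW'.div_const 3).add hS').add (contDiff_const.mul hS))
  have sBmp : ContDiff ℝ ∞ Bmp := Complex.ofRealCLM.contDiff.comp (((hW'.div_const 3).sub hS').sub (contDiff_const.mul hS))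
  have sBmm : ContDiff ℝ ∞ Bmm := Complex.ofRealCLM.contDiff.comp (((((contDiff_const.mul hW').add
    (contDiff_const.mul hW)).sub contDiff_const).sub (contDiff_const.mul hS')).sub (contDiff_const.mul hS))
  set n₁₁ : ℝ → ℂ := fun x => (Λ - Bpp x) * ι₁ x with hn₁₁
  set n₁₂ : ℝ → ℂ := fun x => -Bpm x * ι₁ x with hn₁₂
  set m₂₁ : ℝ → ℂ := fun x => -Bmp x * ι₂ x with hm₂₁
  set m₂₂ : ℝ → ℂ := fun x => (Λ - Bmm x) * ι₂ x with hm₂₂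
  have sn₁₁ : ContDiffOn ℝ ∞ n₁₁ (Ioo (-ρ) ρ) := (contDiffOn_const.sub sBpp.contDiffOn).mul hι₁
  have sn₁₂ : ContDiffOn ℝ ∞ n₁₂ (Ioo (-ρ) ρ) := sBpm.contDiffOn.neg.mul hι₁
  have sm₂₁ : ContDiffOn ℝ ∞ m₂₁ (Ioo (-ρ) ρ) := sBmp.contDiffOn.neg.mul hι₂
  have sm₂₂ : ContDiffOn ℝ ∞ m₂₂ (Ioo (-ρ) ρ) := (contDiffOn_const.sub sBmm.contDiffOn).mul hι₂
  -- the exponent: `n₁₁(0) = ν = m`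
  have hsum0 : deriv W 0 + deriv S 0 ≠ 0 := by linarith
  have hn0 : n₁₁ 0 = ν := by
    obtain ⟨i1, -⟩ := hιeq 0 h0U
    have hs' : ((deriv W 0 : ℝ) : ℂ) + ((deriv S 0 : ℝ) : ℂ) ≠ 0 := by exact_mod_cast hsum0
    simp only [hn₁₁, hνdef, hBpp, i1, hη0]
    push_cast
    field_simp
    ring
  -- globalisation of the coefficients on `[−ρ/2, ρ/2]`
  have hρ2 : (0 : ℝ) < ρ / 2 := by linarith
  have hρ2' : ρ / 2 < ρ := by linarith
  obtain ⟨A₁₁, hA₁₁, eA₁₁⟩ := exists_contDiff_eq_on_Icc hρ2 hρ2' sn₁₁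
  obtain ⟨A₁₂, hA₁₂, eA₁₂⟩ := exists_contDiff_eq_on_Icc hρ2 hρ2' sn₁₂
  obtain ⟨A₂₁, hA₂₁, eA₂₁⟩ := exists_contDiff_eq_on_Icc hρ2 hρ2' sm₂₁
  obtain ⟨A₂₂, hA₂₂, eA₂₂⟩ := exists_contDiff_eq_on_Icc hρ2 hρ2' sm₂₂
  have h0I : (0 : ℝ) ∈ Icc (-(ρ / 2)) (ρ / 2) := ⟨by linarith, by linarith⟩
  have hA0 : A₁₁ 0 = (m : ℂ) := ((eA₁₁ h0I).trans hn0).trans hνm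
  obtain ⟨δ₀, hδ₀, ℓ, hres⟩ := fuchs_branch_resonant m A₁₁ A₁₂ A₂₁ A₂₂ hA₁₁ hA₁₂ hA₂₁ hA₂₂ hA0
  set δ : ℝ := min δ₀ (ρ / 2) with hδ
  have hδpos : 0 < δ := lt_min hδ₀ hρ2
  have hδ1 : δ ≤ 1 := by linarith [min_le_right δ₀ (ρ / 2)]
  have hsub₀ : Ioo (-δ) δ ⊆ Ioo (-δ₀) δ₀ := Ioo_subset_Ioo (neg_le_neg (min_le_left _ _)) (min_le_left _ _)
  have hsubI : Ioo (-δ) δ ⊆ Icc (-(ρ / 2)) (ρ / 2) := fun x hx =>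
    ⟨by linarith [hx.1, min_le_right δ₀ (ρ / 2)], by linarith [hx.2, min_le_right δ₀ (ρ / 2)]⟩
  have hsubρ : Ioo (-δ) δ ⊆ Ioo (-ρ) ρ := fun x hx => ⟨by linarith [(hsubI hx).1], by linarith [(hsubI hx).2]⟩
  have h0δ : (0 : ℝ) ∈ Ioo (-δ) δ := ⟨by linarith, hδpos⟩
  have hdf : ∀ {φ : ℝ → ℂ}, ContDiffOn ℝ ∞ φ (Ioo (-δ) δ) → ∀ y ∈ Ioo (-δ) δ, HasDerivAt φ (deriv φ y) y :=
    fun hφ y hy => ((hφ.differentiableOn (by simp)) y hy |>.differentiableAt (isOpen_Ioo.mem_nhds hy)).hasDerivAt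
  -- KEY CONVERSION: cut-off first-kind system on `(−δ₀, δ₀)` ⇒ resolvent equation for `((p + q)/2, (p − q)/6)` on `(−δ, δ)`
  have key : ∀ (f g T₁ T₂ p q : ℝ → ℂ), EqOn T₁ (fun x => -(f x + 3 * g x) * ι₁ x) (Icc (-(ρ / 2)) (ρ / 2)) →
      EqOn T₂ (fun x => -(f x - 3 * g x) * ι₂ x) (Icc (-(ρ / 2)) (ρ / 2)) → ContDiffOn ℝ ∞ p (Ioo (-δ₀) δ₀) →
      ContDiffOn ℝ ∞ q (Ioo (-δ₀) δ₀) → (∀ x ∈ Ioo (-δ₀) δ₀, (x : ℂ) * deriv p x = A₁₁ x * p x + A₁₂ x * q x + T₁ x ∧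
        deriv q x = A₂₁ x * p x + A₂₂ x * q x + T₂ x) →
      ContDiffOn ℝ ∞ (fun x => (p x + q x) / 2) (Ioo (-δ) δ) ∧ ContDiffOn ℝ ∞ (fun x => (p x - q x) / 6) (Ioo (-δ) δ) ∧
      ∀ x ∈ Ioo (-δ) δ, Λ * ((p x + q x) / 2) - linW r W S (fun x => (p x + q x) / 2) (fun x => (p x - q x) / 6) x = f x ∧
        Λ * ((p x - q x) / 6) - linS r W S (fun x => (p x + q x) / 2) (fun x => (p x - q x) / 6) x = g x := by
    intro f g T₁ T₂ p q eT₁ eT₂ hp hq hpq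
    have hpδ : ContDiffOn ℝ ∞ p (Ioo (-δ) δ) := hp.mono hsub₀
    have hqδ : ContDiffOn ℝ ∞ q (Ioo (-δ) δ) := hq.mono hsub₀
    have hchar : ∀ x ∈ Ioo (-δ) δ,
        ((W x - 1 + S x : ℝ) : ℂ) * deriv p x = (Λ - ((2 / 3 * deriv W x + 2 * W x - r + 2 * deriv S x + 4 * S x : ℝ) : ℂ)) *
          p x - ((deriv W x / 3 + deriv S x + 2 * S x : ℝ) : ℂ) * q x - (f x + 3 * g x) ∧
        ((W x - 1 - S x : ℝ) : ℂ) * deriv q x = -((deriv W x / 3 - deriv S x - 2 * S x : ℝ) : ℂ) * p x +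
          (Λ - ((2 / 3 * deriv W x + 2 * W x - r - 2 * deriv S x - 4 * S x : ℝ) : ℂ)) * q x - (f x - 3 * g x) := by
      intro x hx
      have hxI := hsubI hx
      have hxρ := hsubρ hx
      obtain ⟨e1, e2⟩ := hpq x (hsub₀ hx)
      rw [eA₁₁ hxI, eA₁₂ hxI, eT₁ hxI] at e1
      rw [eA₂₁ hxI, eA₂₂ hxI, eT₂ hxI] at e2
      obtain ⟨i1, i2⟩ := hιeq x hxρ
      obtain ⟨hηx, hcmx⟩ := hne x hxρ
      have hinv₁ : ((dslope (fun y => W y - 1 + S y) 0 x : ℝ) : ℂ) * ι₁ x = 1 := by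
        have hηC : ((dslope (fun y => W y - 1 + S y) 0 x : ℝ) : ℂ) ≠ 0 := Complex.ofReal_ne_zero.2 hηx
        rw [i1]; push_cast at hηC ⊢; field_simp
      have hinv₂ : ((W x - 1 - S x : ℝ) : ℂ) * ι₂ x = 1 := by
        have hc : ((W x - 1 - S x : ℝ) : ℂ) ≠ 0 := Complex.ofReal_ne_zero.2 hcmx.ne
        rw [i2]; push_cast at hc ⊢; field_simp
      have hcp : ((W x - 1 + S x : ℝ) : ℂ) = (x : ℂ) * ((dslope (fun y => W y - 1 + S y) 0 x : ℝ) : ℂ) := by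
        rw [← hxη x]; push_cast; ring
      simp only [hn₁₁, hn₁₂, hBpp, hBpm] at e1
      simp only [hm₂₁, hm₂₂, hBmp, hBmm] at e2
      constructor
      · rw [hcp]
        linear_combination ((dslope (fun y => W y - 1 + S y) 0 x : ℝ) : ℂ) * e1 +
          ((Λ - ((2 / 3 * deriv W x + 2 * W x - r + 2 * deriv S x + 4 * S x : ℝ) : ℂ)) * p x -
            ((deriv W x / 3 + deriv S x + 2 * S x : ℝ) : ℂ) * q x - (f x + 3 * g x)) * hinv₁
      · linear_combination ((W x - 1 - S x : ℝ) : ℂ) * e2 +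
          (-((deriv W x / 3 - deriv S x - 2 * S x : ℝ) : ℂ) * p x +
            (Λ - ((2 / 3 * deriv W x + 2 * W x - r - 2 * deriv S x - 4 * S x : ℝ) : ℂ)) * q x - (f x - 3 * g x)) * hinv₂
    refine ⟨(hpδ.add hqδ).div_const _, (hpδ.sub hqδ).div_const _, fun x hx => ?_⟩
    have dw : deriv (fun x => (p x + q x) / 2) x = (deriv p x + deriv q x) / 2 :=
      (((hdf hpδ x hx).add (hdf hqδ x hx)).div_const 2).deriv
    have ds : deriv (fun x => (p x - q x) / 6) x = (deriv p x - deriv q x) / 6 :=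
      (((hdf hpδ x hx).sub (hdf hqδ x hx)).div_const 6).deriv
    refine (lin_iff_char r W S Λ (fun x => (p x + q x) / 2) (fun x => (p x - q x) / 6) (f x) (g x) x).2 ?_
    rw [dw, ds]
    obtain ⟨e1, e2⟩ := hchar x hx
    have h2 : (p x + q x) / 2 + 3 * ((p x - q x) / 6) = p x := by ring
    have h3 : (p x + q x) / 2 - 3 * ((p x - q x) / 6) = q x := by ring
    constructor
    · have h1 : (deriv p x + deriv q x) / 2 + 3 * ((deriv p x - deriv q x) / 6) = deriv p x := by ring
      rw [h1, h2, h3]; exact e1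
    · have h1 : (deriv p x + deriv q x) / 2 - 3 * ((deriv p x - deriv q x) / 6) = deriv q x := by ring
      rw [h1, h2, h3]; exact e2
  -- the homogeneous data: zero sources, `β = 0`
  have e0 : EqOn (fun _ : ℝ => (0 : ℂ)) (fun x => -((fun _ : ℝ => (0 : ℂ)) x + 3 * (fun _ : ℝ => (0 : ℂ)) x) * ι₁ x)
      (Icc (-(ρ / 2)) (ρ / 2)) := fun x _ => by simp
  have e0' : EqOn (fun _ : ℝ => (0 : ℂ)) (fun x => -((fun _ : ℝ => (0 : ℂ)) x - 3 * (fun _ : ℝ => (0 : ℂ)) x) * ι₂ x)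
      (Icc (-(ρ / 2)) (ρ / 2)) := fun x _ => by simp
  obtain ⟨β₀, hβ₀flag, hhom⟩ := hres (fun _ => 0) (fun _ => 0) contDiff_const contDiff_const
  have hβ₀ : β₀ = 0 := hβ₀flag (fun _ => rfl) (fun _ => rfl)
  have hpq_id : ∀ (p q : ℝ → ℂ) (x : ℝ), (p x + q x) / 2 + 3 * ((p x - q x) / 6) = p x ∧
      (p x + q x) / 2 - 3 * ((p x - q x) / 6) = q x := fun p q x => ⟨by ring, by ring⟩
  have hcontm : ∀ {p : ℝ → ℂ}, ContDiffOn ℝ ∞ p (Ioo (-δ₀) δ₀) → ContinuousAt (iteratedDeriv m p) 0 := by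
    intro p hp
    have hO : IsOpen (Ioo (-δ₀) δ₀) := isOpen_Ioo
    have h0 : (0 : ℝ) ∈ Ioo (-δ₀) δ₀ := ⟨by linarith, hδ₀⟩
    have hc : ContinuousOn (iteratedDerivWithin m p (Ioo (-δ₀) δ₀)) (Ioo (-δ₀) δ₀) :=
      hp.continuousOn_iteratedDerivWithin (by exact_mod_cast le_top) (uniqueDiffOn_Ioo _ _)
    have hc' : ContinuousOn (iteratedDeriv m p) (Ioo (-δ₀) δ₀) :=
      hc.congr fun y hy => ((iteratedDerivWithin_of_isOpen hO) hy).symm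
    exact hc'.continuousAt (hO.mem_nhds h0)
  have hderm0 : ∀ {p : ℝ → ℂ}, (∀ y ∈ Ioo (-δ) 0, p y = 0) → ∀ y ∈ Ioo (-δ) 0, iteratedDeriv m p y = 0 := by
    intro p hp y hy
    have hev : p =ᶠ[𝓝 y] fun _ => 0 := by
      filter_upwards [isOpen_Ioo.mem_nhds hy] with z hz
      exact hp z hz
    rw [Filter.EventuallyEq.iteratedDeriv_eq m hev]
    simp
  -- THE NON-TRIVIAL HOMOGENEOUS SOLUTION: data `(q(0), p⁽ᵐ⁾(0)) = (0, 1)`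
  obtain ⟨ph, qh, hph, hqh, -, hpm, hhpq⟩ := hhom 0 1 (by rw [hβ₀]; ring)
  obtain ⟨hwh, hsh, hsolh⟩ := key _ _ _ _ ph qh e0 e0' hph hqh hhpq
  have hneh : ∃ x ∈ Ioo (-δ) δ, (fun x => (ph x + qh x) / 2) x ≠ 0 ∨ (fun x => (ph x - qh x) / 6) x ≠ 0 := by
    by_contra hcon
    push Not at hcon
    have hp0 : ∀ y ∈ Ioo (-δ) δ, ph y = 0 := fun y hy => by
      obtain ⟨h1, h2⟩ := hcon y hy
      rw [← (hpq_id ph qh y).1, h1, h2]; ring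
    have hev : ph =ᶠ[𝓝 0] fun _ => 0 := by
      filter_upwards [isOpen_Ioo.mem_nhds h0δ] with z hz
      exact hp0 z hz
    have : iteratedDeriv m ph 0 = 0 := by rw [Filter.EventuallyEq.iteratedDeriv_eq m hev]; simp
    rw [hpm] at this
    exact one_ne_zero this
  refine ⟨δ, hδpos, hδ1, ⟨_, _, hwh, hsh, hsolh, hneh⟩, ?_⟩
  by_cases hℓ : ℓ = 0
  · -- `ℓ = 0`: THE TWO-DIMENSIONAL HOMOGENEOUS BRANCH
    right
    obtain ⟨p₁, q₁, hp₁, hq₁, hq₁0, hp₁m, h₁⟩ := hhom 1 0 (by rw [hβ₀, hℓ]; ring)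
    obtain ⟨p₂, q₂, hp₂, hq₂, hq₂0, hp₂m, h₂⟩ := hhom 0 1 (by rw [hβ₀, hℓ]; ring)
    obtain ⟨hw₁, hs₁, hsol₁⟩ := key _ _ _ _ p₁ q₁ e0 e0' hp₁ hq₁ h₁
    obtain ⟨hw₂, hs₂, hsol₂⟩ := key _ _ _ _ p₂ q₂ e0 e0' hp₂ hq₂ h₂
    refine ⟨_, _, _, _, hw₁, hs₁, hw₂, hs₂, hsol₁, hsol₂, fun t₁ t₂ hvan => ?_⟩
    -- the `q`-combination vanishes on `(−δ, 0)`, hence at `0`: `t₁ = 0`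
    have hQ : ∀ y ∈ Ioo (-δ) 0, t₁ * q₁ y + t₂ * q₂ y = 0 := by
      intro y hy
      obtain ⟨h1, h2⟩ := hvan y hy
      rw [← (hpq_id p₁ q₁ y).2, ← (hpq_id p₂ q₂ y).2]
      linear_combination h1 - 3 * h2
    have hqc : ∀ {q : ℝ → ℂ}, ContDiffOn ℝ ∞ q (Ioo (-δ₀) δ₀) → ContinuousAt q 0 := fun hq =>
      (hq.continuousOn.continuousWithinAt ⟨by linarith, hδ₀⟩).continuousAt (isOpen_Ioo.mem_nhds ⟨by linarith, hδ₀⟩)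
    have ht₁ : t₁ = 0 := by
      have h := eq_zero_of_eq_zero_on_left (Φ := fun y => t₁ * q₁ y + t₂ * q₂ y) hδpos
        ((continuousAt_const.mul (hqc hq₁)).add (continuousAt_const.mul (hqc hq₂))) hQ
      simp only [hq₁0, hq₂0, mul_one, mul_zero, add_zero] at h
      exact h
    -- the `p`-combination vanishes on `(−δ, 0)`, hence so does `t₂ p₂⁽ᵐ⁾`, and at `0`: `t₂ = 0`
    have hP : ∀ y ∈ Ioo (-δ) 0, t₂ * p₂ y = 0 := by
      intro y hy
      obtain ⟨h1, h2⟩ := hvan y hy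
      rw [← (hpq_id p₂ q₂ y).1]
      rw [ht₁] at h1 h2
      linear_combination h1 + 3 * h2
    refine ⟨ht₁, ?_⟩
    by_contra ht₂
    have hp0 : ∀ y ∈ Ioo (-δ) 0, p₂ y = 0 := fun y hy => (mul_eq_zero.1 (hP y hy)).resolve_left ht₂
    have h := eq_zero_of_eq_zero_on_left hδpos (hcontm hp₂) (hderm0 hp0)
    rw [hp₂m] at h
    exact one_ne_zero h
  · -- `ℓ ≠ 0`: PARTICULAR SOLUTIONS FOR EVERY SOURCE
    left
    intro f g hf hg
    have sτ₁ : ContDiffOn ℝ ∞ (fun x => -(f x + 3 * g x) * ι₁ x) (Ioo (-ρ) ρ) :=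
      (hf.add (contDiff_const.mul hg)).contDiffOn.neg.mul hι₁
    have sτ₂ : ContDiffOn ℝ ∞ (fun x => -(f x - 3 * g x) * ι₂ x) (Ioo (-ρ) ρ) :=
      (hf.sub (contDiff_const.mul hg)).contDiffOn.neg.mul hι₂
    obtain ⟨T₁, hT₁, eT₁⟩ := exists_contDiff_eq_on_Icc hρ2 hρ2' sτ₁
    obtain ⟨T₂, hT₂, eT₂⟩ := exists_contDiff_eq_on_Icc hρ2 hρ2' sτ₂
    obtain ⟨β, -, hpart⟩ := hres T₁ T₂ hT₁ hT₂
    obtain ⟨p, q, hp, hq, -, -, hpq⟩ := hpart (-(β / ℓ)) 0 (by field_simp; ring)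
    obtain ⟨hw, hs, hsol⟩ := key f g T₁ T₂ p q eT₁ eT₂ hp hq hpq
    exact ⟨_, _, hw, hs, hsol⟩



/-- **Registered helper `mode_of_two_local_branches`: A TWO-DIMENSIONAL SMOOTH HOMOGENEOUS BRANCH AT THE SONIC POINT
FORCES A SMOOTH RADIAL MODE.** See the module docstring. [folklore] -/
theorem mode_of_two_local_branches : ∀ (r : ℝ) (W S : ℝ → ℝ), IsMonatomicProfile r W S → CavityTube r W S → ∀ (Λ : ℂ) (δ : ℝ), 0 < δ → δ ≤ 1 → (∃ w₁ s₁ w₂ s₂ : ℝ → ℂ, ContDiffOn ℝ ∞ w₁ (Set.Ioo (-δ) δ) ∧ ContDiffOn ℝ ∞ s₁ (Set.Ioo (-δ) δ) ∧ ContDiffOn ℝ ∞ w₂ (Set.Ioo (-δ) δ) ∧ ContDiffOn ℝ ∞ s₂ (Set.Ioo (-δ) δ) ∧ (∀ x ∈ Set.Ioo (-δ) δ, Λ * w₁ x - linW r W S w₁ s₁ x = 0 ∧ Λ * s₁ x - linS r W S w₁ s₁ x = 0) ∧ (∀ x ∈ Set.Ioo (-δ) δ, Λ * w₂ x - linW r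 W S w₂ s₂ x = 0 ∧ Λ * s₂ x - linS r W S w₂ s₂ x = 0) ∧ ∀ t₁ t₂ : ℂ, (∀ x ∈ Set.Ioo (-δ) 0, t₁ * w₁ x + t₂ * w₂ x = 0 ∧ t₁ * s₁ x + t₂ * s₂ x = 0) → t₁ = 0 ∧ t₂ = 0) → ∃ ŵ ŝ : ℝ → ℂ, IsSmoothRadialMode r W S Λ ŵ ŝ := by
  intro r W S hP hT Λ δ hδ hδ1 htwo
  obtain ⟨w₁, s₁, w₂, s₂, hw₁, hs₁, hw₂, hs₂, hsol₁, hsol₂, hnd⟩ := htwo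
  have h0c : ContDiff ℝ ∞ (fun _ : ℝ => (0 : ℂ)) := contDiff_const
  -- the centre-regular homogeneous branch on `x ≤ -1` and its continuation to `x ≤ -δ/4`
  obtain ⟨⟨wc, sc, hregc, hsolc, hnec⟩, -⟩ := centre_regular_branch r W S hP hT Λ 1 one_pos
  obtain ⟨x', hx', hne'⟩ := exists_ne_zero_lt hP hT zero_le_one hregc hsolc hnec
  have hsolc' : ∀ x ∈ Iic (-1 : ℝ), Λ * wc x - linW r W S wc sc x = (fun _ : ℝ => (0 : ℂ)) x ∧
      Λ * sc x - linS r W S wc sc x = (fun _ : ℝ => (0 : ℂ)) x := fun x hx =>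
    ⟨sub_eq_zero.2 (hsolc x hx).1, sub_eq_zero.2 (hsolc x hx).2⟩
  obtain ⟨Wc, Sc, hregC, hsolC, eC, eC'⟩ := extend_regular_left hP hT Λ h0c h0c hregc (c := -1) (d := -(δ / 4))
    (by linarith) (by linarith) hsolc'
  have dWc : Differentiable ℝ Wc := hregC.1.differentiable (by simp)
  have dSc : Differentiable ℝ Sc := hregC.2.1.differentiable (by simp)
  have dI : ∀ {φ : ℝ → ℂ}, ContDiffOn ℝ ∞ φ (Ioo (-δ) δ) → ∀ x ∈ Ioo (-δ) δ, DifferentiableAt ℝ φ x :=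
    fun hφ x hx => (hφ.differentiableOn (by simp)).differentiableAt (Ioo_mem_nhds hx.1 hx.2)
  have hleft : ∀ a : ℂ, IsRegularPair (fun x => a * Wc x) (fun x => a * Sc x) ∧
      ∀ x ∈ Iic (-(δ / 4)), Λ * (a * Wc x) - linW r W S (fun y => a * Wc y) (fun y => a * Sc y) x = 0 ∧
        Λ * (a * Sc x) - linS r W S (fun y => a * Wc y) (fun y => a * Sc y) x = 0 := by
    intro a
    refine ⟨isRegularPair_const_mul a hregC, fun x hx => ?_⟩
    obtain ⟨l1, l2⟩ := lin_const_mul (r := r) (W := W) (S := S) a (dWc x) (dSc x)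
    obtain ⟨c1, c2⟩ := hsolC x hx
    rw [l1, l2]
    exact ⟨by linear_combination a * c1, by linear_combination a * c2⟩
  have hright : ∀ (u v : ℝ → ℂ) (t : ℂ), ContDiffOn ℝ ∞ u (Ioo (-δ) δ) → ContDiffOn ℝ ∞ v (Ioo (-δ) δ) →
      (∀ x ∈ Ioo (-δ) δ, Λ * u x - linW r W S u v x = 0 ∧ Λ * v x - linS r W S u v x = 0) →
      ContDiffOn ℝ ∞ (fun x => u x + t * w₁ x) (Ioo (-δ) δ) ∧ ContDiffOn ℝ ∞ (fun x => v x + t * s₁ x) (Ioo (-δ) δ) ∧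
      ∀ x ∈ Ioo (-δ) δ, Λ * (u x + t * w₁ x) - linW r W S (fun y => u y + t * w₁ y) (fun y => v y + t * s₁ y) x = 0 ∧
        Λ * (v x + t * s₁ x) - linS r W S (fun y => u y + t * w₁ y) (fun y => v y + t * s₁ y) x = 0 := by
    intro u v t hu hv hsol
    refine ⟨hu.add (contDiffOn_const.mul hw₁), hv.add (contDiffOn_const.mul hs₁), fun x hx => ?_⟩
    obtain ⟨l1, l2⟩ := lin_add_const_mul (r := r) (W := W) (S := S) t (dI hu x hx) (dI hv x hx) (dI hw₁ x hx)
      (dI hs₁ x hx)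
    obtain ⟨p1, p2⟩ := hsol x hx
    obtain ⟨c1, c2⟩ := hsol₁ x hx
    rw [l1, l2]
    exact ⟨by linear_combination p1 + t * c1, by linear_combination p2 + t * c2⟩
  have hmode : ∀ (ŵ ŝ : ℝ → ℂ), IsRegularPair ŵ ŝ → (∀ x, Λ * ŵ x - linW r W S ŵ ŝ x = 0 ∧ Λ * ŝ x - linS r W S ŵ ŝ x = 0) →
      (∃ x, ŵ x ≠ 0 ∨ ŝ x ≠ 0) → IsSmoothRadialMode r W S Λ ŵ ŝ := fun ŵ ŝ hreg hsol hne =>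
    ⟨hreg, hne, fun x => ⟨sub_eq_zero.1 (hsol x).1, sub_eq_zero.1 (hsol x).2⟩⟩
  -- the matching map at `x* = -δ/2`
  set xs : ℝ := -(δ / 2) with hxs
  obtain ⟨T, hTmap⟩ := exists_matchingMap (Wc xs) (w₁ xs) (Sc xs) (s₁ xs)
  by_cases hinj : Function.Injective T
  · -- `T` BIJECTIVE: glue `a`·centre to `second + t·first`
    obtain ⟨⟨a, t⟩, hat⟩ := (LinearMap.injective_iff_surjective.1 hinj) (w₂ xs, s₂ xs)
    rw [hTmap, Prod.mk.injEq] at hat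
    obtain ⟨e1, e2⟩ := hat
    obtain ⟨hL, hsolL⟩ := hleft a
    obtain ⟨hR1, hR2, hsolR⟩ := hright w₂ s₂ t hw₂ hs₂ hsol₂
    obtain ⟨ŵ, ŝ, hreg, hsol, -, -, ew', es'⟩ := glue_centre_sonic r W S hP hT Λ _ _ h0c h0c δ hδ hδ1 _ _ _ _ hL hsolL hR1
      hR2 hsolR (by linear_combination e1) (by linear_combination e2)
    refine ⟨ŵ, ŝ, hmode ŵ ŝ hreg hsol ?_⟩
    -- non-triviality on `(−δ, 0)` from non-degeneracy with `(t₁, t₂) = (t, 1)`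
    by_contra hall
    push Not at hall
    have := (hnd t 1 fun x hx => ?_).2
    · exact one_ne_zero this
    have hxδ : x ∈ Ioo (-δ) δ := ⟨hx.1, hx.2.trans hδ⟩
    obtain ⟨h1, h2⟩ := hall x
    rw [ew' hxδ] at h1
    rw [es' hxδ] at h2
    simp only at h1 h2
    exact ⟨by linear_combination h1, by linear_combination h2⟩
  · -- A KERNEL VECTOR: glue `a`·centre to `t`·first
    obtain ⟨⟨a, t⟩, hT0, hne⟩ : ∃ v : ℂ × ℂ, T v = 0 ∧ v ≠ 0 := by
      by_contra h
      push Not at h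
      exact hinj ((injective_iff_map_eq_zero T).2 h)
    rw [hTmap, Prod.mk_eq_zero] at hT0
    obtain ⟨e1, e2⟩ := hT0
    obtain ⟨hL, hsolL⟩ := hleft a
    obtain ⟨hR1, hR2, hsolR⟩ := hright (fun _ => 0) (fun _ => 0) t contDiffOn_const contDiffOn_const
      (fun x _ => by simp [lin_zero])
    obtain ⟨ŵ, ŝ, hreg, hsol, ew, es, ew', es'⟩ := glue_centre_sonic r W S hP hT Λ _ _ h0c h0c δ hδ hδ1 _ _ _ _ hL hsolL
      hR1 hR2 hsolR (by linear_combination e1) (by linear_combination e2)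
    refine ⟨ŵ, ŝ, hmode ŵ ŝ hreg hsol ?_⟩
    by_cases ha : a = 0
    · -- `a = 0 ≠ t`: non-trivial on `(−δ, 0)` by non-degeneracy with `(t₁, t₂) = (t, 0)`
      have ht : t ≠ 0 := fun ht => hne (Prod.mk_eq_zero.2 ⟨ha, ht⟩)
      by_contra hall
      push Not at hall
      refine ht (hnd t 0 fun x hx => ?_).1
      have hxδ : x ∈ Ioo (-δ) δ := ⟨hx.1, hx.2.trans hδ⟩
      obtain ⟨h1, h2⟩ := hall x
      rw [ew' hxδ] at h1
      rw [es' hxδ] at h2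
      simp only [zero_add] at h1 h2
      exact ⟨by linear_combination h1, by linear_combination h2⟩
    · -- `a ≠ 0`: non-trivial at the point `x' < -1`
      have hx'δ : x' ∈ Iio (-(δ / 4)) := show x' < -(δ / 4) by linarith
      refine ⟨x', ?_⟩
      rw [ew hx'δ, es hx'δ]
      simp only
      rw [eC hx', eC' hx']
      rcases hne' with h1 | h1
      · exact Or.inl (mul_ne_zero ha h1)
      · exact Or.inr (mul_ne_zero ha h1)

/-- **Registered helper `cavity_resolvent_pointwise_res`: POINTWISE EXISTENCE OF THE SMOOTH CENTRE-REGULAR RESOLVENT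
SOLUTION AT THE JET RESONANCES `ν(Λ) = m ∈ ℕ`.** See the module docstring. [folklore] -/
theorem cavity_resolvent_pointwise_res : ∀ (r : ℝ) (W S : ℝ → ℝ), (17307 / 15625 : ℝ) ≤ r → r ≤ 697 / 625 → IsMonatomicProfile r W S → OrigProfileEqs r W S → CavityTube r W S → BoxPackage r W S → RealBound r W S → SonicConfinement r W S → ∀ Λ₁ : ℝ, 6 * (r - 1) < Λ₁ → Λ₁ < 9 * (r - 1) → (∃ ŵ ŝ : ℝ → ℂ, IsSmoothRadialMode r W S (Λ₁ : ℂ) ŵ ŝ) → ∀ Λ : ℂ, -(1 / 5 : ℝ) ≤ Λ.re → (1 / 20 : ℝ) ≤ ‖Λ‖ → (1 / 20 : ℝ) ≤ ‖Λ - (Λ₁ : ℂ)‖ → (1 / 20 : ℝ) ≤ ‖Λ - (r : ℂ)‖ → ∀ m : ℕ, ((((2 / 3 * deriv W 0 + 2 * deriv S 0 + 2 * W 0 + 4 * S 0 - r : ℝ) : ℂ) - Λ) / ((-(deriv W 0 + deriv S 0) : ℝ) : ℂ)) = (m : ℂ) → ∀ (f g : ℝ → ℂ), IsRegularPair f g →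 ∃ ŵ ŝ : ℝ → ℂ, IsRegularPair ŵ ŝ ∧ ∀ x, Λ * ŵ x - linW r W S ŵ ŝ x = f x ∧ Λ * ŝ x - linS r W S ŵ ŝ x = g x := by
  intro r W S _ h2 hP _ hT hbox hre him Λ₁ h6 h9 hmode Λ hΛre hΛ0 hΛ1 hΛr m hνm f g hfg
  have h2' : r ≤ 89409 / 80000 := h2.trans (by norm_num)
  obtain ⟨δ, hδ, hδ1, hh, halt⟩ := sonic_branch_resonant r W S hP hT Λ m hνm
  rcases halt with hpart | htwo
  · exact cavity_resolvent_of_local r W S h2' hP hT hbox hre him Λ₁ h6 h9 hmode Λ hΛre hΛ0 hΛ1 hΛr δ hδ hδ1 hh f g hfg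
      (hpart f g hfg.1 hfg.2.1)
  · exfalso
    obtain ⟨ŵ, ŝ, hm⟩ := mode_of_two_local_branches r W S hP hT Λ δ hδ hδ1 htwo
    have hΛ4 : -(1 / 4 : ℝ) < Λ.re := by linarith
    rcases rate_eq_of_window r W S h2' hbox hre him Λ₁ h6 h9 hmode Λ hΛ4 ⟨ŵ, ŝ, hm⟩ with h | h | h
    · rw [h, sub_self, norm_zero] at hΛ1; linarith
    · rw [h, sub_self, norm_zero] at hΛr; linarith
    · rw [h, norm_zero] at hΛ0; linarith

/-- **Registered helper `cavity_resolvent_pointwise` (T6): POINTWISE EXISTENCE OF THE SMOOTH CENTRE-REGULAR RESOLVENT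
SOLUTION ON THE WHOLE REGION** (see the module docstring). [folklore] -/
theorem cavity_resolvent_pointwise : ∀ (r : ℝ) (W S : ℝ → ℝ), (17307 / 15625 : ℝ) ≤ r → r ≤ 697 / 625 → IsMonatomicProfile r W S → OrigProfileEqs r W S → CavityTube r W S → BoxPackage r W S → RealBound r W S → SonicConfinement r W S → ∀ Λ₁ : ℝ, 6 * (r - 1) < Λ₁ → Λ₁ < 9 * (r - 1) → (∃ ŵ ŝ : ℝ → ℂ, IsSmoothRadialMode r W S (Λ₁ : ℂ) ŵ ŝ) → ∀ Λ : ℂ, -(1 / 5 : ℝ) ≤ Λ.re → (1 / 20 : ℝ) ≤ ‖Λ‖ → (1 / 20 : ℝ) ≤ ‖Λ - (Λ₁ : ℂ)‖ → (1 / 20 : ℝ) ≤ ‖Λ - (r : ℂ)‖ → ∀ (f g : ℝ → ℂ), IsRegularPair f g → ∃ ŵ ŝ : ℝ → ℂ, IsRegularPair ŵ ŝ ∧ ∀ x, Λ * ŵ x - linW r W S ŵ ŝ x = f x ∧ Λ * ŝ x - linS r W S ŵ ŝ x = g x := by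
  intro r W S h1 h2 hP hE hT hbox hre him Λ₁ h6 h9 hmode Λ hΛre hΛ0 hΛ1 hΛr f g hfg
  by_cases hres : ∃ m : ℕ, ((((2 / 3 * deriv W 0 + 2 * deriv S 0 + 2 * W 0 + 4 * S 0 - r : ℝ) : ℂ) - Λ) /
      ((-(deriv W 0 + deriv S 0) : ℝ) : ℂ)) = (m : ℂ)
  · obtain ⟨m, hm⟩ := hres
    exact cavity_resolvent_pointwise_res r W S h1 h2 hP hE hT hbox hre him Λ₁ h6 h9 hmode Λ hΛre hΛ0 hΛ1 hΛr m hm f g hfg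
  · push Not at hres
    exact cavity_resolvent_pointwise_offres r W S h1 h2 hP hE hT hbox hre him Λ₁ h6 h9 hmode Λ hΛre hΛ0 hΛ1 hΛr
      (fun m _ => hres m) f g hfg

end Summit.AtomisticToContinuum.HydrodynamicLimit.Theorems.SonicCavityRenewal

end
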